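/-
Copyright (c) 2026. All rights reserved.
Released under Apache 2.0 license as described in the file LICENSE.
Authors: abc-iut cell, prover seat abc-iut-L4-t5 (gen 9), over the statements of abc-iut-L4-t3, the necessity theorem of
abc-iut-w5-d097 and the `⊞`-side coherence theorem of abc-iut-f-101 (`LogFrobeniusObservablesOfIotaSquare.lean`), of which
this file is the `TS`-side analogue.
-/
import Literature.AnabelianGeometry.AbsoluteAnabelian.LogFrobeniusObservablesTSMoves
import Literature.AnabelianGeometry.AbsoluteAnabelian.LogFrobeniusObservablesOfIotaSquare
import Literature.AnabelianGeometry.AbsoluteAnabelian.LogFrobeniusObservablesTSIotaSquare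
import HarnessLib

/-!
# [AbsTopIII] Corollary 5.5 (iii), `TS`-half: the `TS` ι-diamond law and the COHERENCE of the move system of the observable `S_log`

S. Mochizuki, *Topics in absolute anabelian geometry III: global reconstruction algorithms*,
J. Math. Sci. Univ. Tokyo 22 (2015) 939–1156 [MochizukiAbsTopIII2015]; locators `p.N` = pages of the author's
manuscript (`paper:url-5493eb38cbb7`): Def 5.4 (iii) p. 126 ("a commutative diagram" defining `Γ⃗^log_non`), (v) p. 127,
(vii) p. 128 (the `TS`-valued `ι_{v,ε}` for every edge of `Γ⃗^log_v`; on `Γ⃗^⋉_v` it is `ι⊞_{v,ε}` composed with `𝒩⊞_v → 𝒩_v`),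
Cor 5.5 (iii) p. 131 (the observable `S_log` determined by the `ι_{v,ε}`), proof p. 132 ("immediate from the definitions"),
§0 p. 26 / Def 3.5 (ii)–(iii) pp. 75–76 (saturation; families of homotopies; observables).

PROOF companion (one definition: the hypothesis `IotaSquaresCommuteTS`) of abc-iut-L4-t3's `LogFrobeniusObservables.lean`
(`IsLogObservableTS`, `Cor55ObservablesTS` = FACT-LIST F-3080), over the move system `LogGenTS` / `logGenHomTS` of
`LogFrobeniusObservablesTSMoves.lean`:

* `IotaSquaresCommuteTS T v` — the `TS` ι-DIAMOND LAW at `v` (for any two 2-chains `νa → νb → νd`, `νa → νc → νd` of edges of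
  `Γ⃗^log_v` through pre-log `νb`, `νc`: `ι_{ε₁} ≫ ι_{ε₂} = ι_{ε₃} ≫ ι_{ε₄}` componentwise on `𝒩_v`, in exactly the form of
  abc-iut-w5-d097's `TSHomotopies.iota_diamond_of_isLogObservableTS`, which gives its NECESSITY:
  `iotaSquaresCommuteTS_of_isLogObservableTS`);
* `iotaSquaresCommuteTS_of_iotaSquaresCommute` — abc-iut-f-101's `⊞`-square condition `IotaSquaresCommute L v` implies the
  `TS` law for EVERY `TS`-datum `T` (by `LogVertex.logEdgeTS_diamond_toTS` the only non-degenerate diamond of `Γ⃗^log_v` is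
  print's Def 5.4 (iii) square inside `Γ⃗^⋉_v`, where `ι = ι⊞ ▹ (𝒩⊞_v → 𝒩_v)` by the field `TSHomotopies.iota_toTS`; apply the
  functor `𝒩⊞_v → 𝒩_v`; the `TS`-only `ι_{v,k̄^×↪k̄}` enters no square);
* ★ `chain_hom_eq_of_iotaSquaresCommuteTS` — COHERENCE: under the `TS` law any two chains of moves between the same two paths
  of the `TS`-shape have the same homotopy.  Induction on the weight of the source path, as on the `⊞`-side: the first moves
  of two chains out of one path coincide (unique decomposition; `chain_from_lamPathTS`) unless they take the two branches of
  a fork of `Γ⃗^log_v` (`LogVertex.logEdgeTS_fork`).  The CLOSING fork `𝒪^×_k̄ → {k̄^×, k~}` closes into the sink `(k̄^×)^pf`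
  with equal composites (`moveHomTS_square`, `fork_closing_hom_eq`) — its `k̄^×`-branch cannot escape through the `TS`-only
  exit `k̄^× ↪ k̄` and still meet the other branch, because a chain out of `[λ_{k̄}]∘r` is empty or starts with the `post`-move
  after which every path weighs less than `r` (`chain_from_lamPathTS_spaceLink`); the `TS`-only DIVERGING fork
  `k̄^× → {(k̄^×)^pf, k̄}` can never be rejoined (`fork_diverging_false`).

The construction of `S_log` from coherence (toolkit `chainFamily`) and the consequences for F-3080 are in
`LogFrobeniusObservablesTSOfIotaSquare.lean`.  HONEST LABEL: `IotaSquaresCommuteTS` is a definition (a hypothesis), not a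
new fact; nothing is asserted about any particular `(L, T)`.  Refereed pre-IUT material; nothing here bears on [IUTchIII]
Cor. 3.12; OUR kernel check, no side taken.
-/

set_option autoImplicit false

universe u

open CategoryTheory Quiver

namespace Literature.AnabelianGeometry.AbsoluteAnabelian

namespace LogFrobeniusSetting

variable {Vmod : Type u} {isArc : Vmod → Bool} (L : LogFrobeniusSetting Vmod isArc) (v : Vmod)

/-! ## The `TS` ι-diamond law and its derivation from the `⊞`-square condition -/

/-- **The `TS` ι-diamond law at `v`** — a CONDITION on the pair `(L, T)` (the Def 5.4 (iii) commutativity at the level of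
the `TS`-valued `ι_{v,ε}`; a PREDICATE on the interface, refutable at some data — abc-iut-w5-d097's
`exists_not_cor55ObservablesTS` — NOT a fact and never assumed in this file): for any two 2-chains `νa → νb → νd`,
`νa → νc → νd` of edges of `Γ⃗^log_v` through pre-log vertices `νb`, `νc`, the composites of the `ι`-components agree on `𝒩_v`
(the one cast `λ_{νb} = Λ_{νb} ∘ λ_{νb}` made explicit, as in `TSHomotopies.iota_diamond_of_isLogObservableTS`).
[cite: MochizukiAbsTopIII2015, Def 5.4 (iii) p. 126] -/
def IotaSquaresCommuteTS (T : L.TSHomotopies) (v : Vmod) : Prop :=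
  ∀ ⦃νa νb νc νd : LogVertex (isArc v)⦄ (hb : νb.isPostLog = false) (hc : νc.isPostLog = false)
    (ε₁ : LogEdgeTS (isArc v) νa νb) (ε₂ : LogEdgeTS (isArc v) νb νd) (ε₃ : LogEdgeTS (isArc v) νa νc)
    (ε₄ : LogEdgeTS (isArc v) νc νd) (X₀ : L.X),
    (T.iota v ε₁).app X₀ ≫ eqToHom (L.lam_forget_obj_eq_twist_obj v hb X₀) ≫ (T.iota v ε₂).app X₀ =
      (T.iota v ε₃).app X₀ ≫ eqToHom (L.lam_forget_obj_eq_twist_obj v hc X₀) ≫ (T.iota v ε₄).app X₀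

variable (T : L.TSHomotopies)

/-- **NECESSITY** (abc-iut-w5-d097, by name): an observable `S_log` at `v` forces the `TS` ι-diamond law at `v` (degenerate
diamonds — both 2-chains through the same middle vertex, or out of the post-log vertex — hold trivially: edges of `Γ⃗^log_v`
are determined by their end-vertices). [cite: MochizukiAbsTopIII2015, Cor 5.5 (iii) p. 131] -/
theorem iotaSquaresCommuteTS_of_isLogObservableTS (H : (L.logDiagramTS v).HomotopyFamily)
    (hH : L.IsLogObservableTS T v H) : L.IotaSquaresCommuteTS T v := by
  intro νa νb νc νd hb hc ε₁ ε₂ ε₃ ε₄ X₀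
  rcases Bool.eq_false_or_eq_true νa.isPostLog with ha | ha
  · obtain rfl : νb = νc := LogVertex.logEdgeTS_post_target_eq _ ha ε₁ ε₃
    rw [LogVertex.logEdgeTS_subsingleton _ ε₃ ε₁, LogVertex.logEdgeTS_subsingleton _ ε₄ ε₂]
  · exact T.iota_diamond_of_isLogObservableTS v hH ha hb hc (LogVertex.isPostLog_eq_false_of_logEdgeTS _ ε₂)
      ε₁ ε₂ ε₃ ε₄ X₀

/-- **The `⊞`-square condition implies the `TS` ι-diamond law, for EVERY `TS`-datum** (Def 5.4 (vii): on `Γ⃗^⋉_v` the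
`TS`-valued `ι_{v,ε}` is `ι⊞_{v,ε}` composed with `𝒩⊞_v → 𝒩_v`, and by `LogVertex.logEdgeTS_diamond_toTS` every non-degenerate
diamond of `Γ⃗^log_v` lies in `Γ⃗^⋉_v`: apply the functor `𝒩⊞_v → 𝒩_v` to abc-iut-f-101's `⊞`-square).
[cite: MochizukiAbsTopIII2015, Def 5.4 (vii) p. 128] -/
theorem iotaSquaresCommuteTS_of_iotaSquaresCommute (hsq : L.IotaSquaresCommute v) : L.IotaSquaresCommuteTS T v := by
  intro νa νb νc νd hb hc ε₁ ε₂ ε₃ ε₄ X₀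
  by_cases hbc : νb = νc
  · subst hbc
    rw [LogVertex.logEdgeTS_subsingleton _ ε₃ ε₁, LogVertex.logEdgeTS_subsingleton _ ε₄ ε₂]
  · obtain ⟨ha, hd, e₁, e₂, e₃, e₄, rfl, rfl, rfl, rfl⟩ := LogVertex.logEdgeTS_diamond_toTS _ ε₁ ε₂ ε₃ ε₄ hbc
    have ta : (L.lam v νa).obj X₀ = (frobeniusTwist L.log νa.isPostLog ⋙ L.lam v νa).obj X₀ := by
      simp [frobeniusTwist, ha]
    have tb : (L.lam v νb).obj X₀ = (frobeniusTwist L.log νb.isPostLog ⋙ L.lam v νb).obj X₀ := by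
      simp [frobeniusTwist, hb]
    have tc : (L.lam v νc).obj X₀ = (frobeniusTwist L.log νc.isPostLog ⋙ L.lam v νc).obj X₀ := by
      simp [frobeniusTwist, hc]
    have key := hsq ha hb hc hd e₁ e₂ e₃ e₄ X₀
      (eqToHom ta ≫ (L.iota v e₁).app X₀ ≫ eqToHom (rfl : (L.lam v νb).obj X₀ = _).symm)
      (eqToHom tb ≫ (L.iota v e₂).app X₀ ≫ eqToHom (rfl : (L.lam v νd).obj X₀ = _).symm)
      (eqToHom ta ≫ (L.iota v e₃).app X₀ ≫ eqToHom (rfl : (L.lam v νc).obj X₀ = _).symm)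
      (eqToHom tc ≫ (L.iota v e₄).app X₀ ≫ eqToHom (rfl : (L.lam v νd).obj X₀ = _).symm)
      ((conj_eqToHom_iff_heq _ _ ta rfl).mp rfl) ((conj_eqToHom_iff_heq _ _ tb rfl).mp rfl)
      ((conj_eqToHom_iff_heq _ _ ta rfl).mp rfl) ((conj_eqToHom_iff_heq _ _ tc rfl).mp rfl)
    simp only [eqToHom_refl, Category.comp_id, Category.assoc] at key
    have mid := (cancel_epi _).mp key
    have img := congrArg (fun f => (L.forget v).map f) mid
    simp only [Functor.map_comp, eqToHom_map] at img
    rw [T.iota_toTS, T.iota_toTS, T.iota_toTS, T.iota_toTS]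
    simp only [Functor.whiskerRight_app]
    exact img

/-! ## Moves on the `TS`-shape: composition, first-move analysis, the commuting square -/

/-- `moveHom` is multiplicative in the generator homotopy (composition of two moves with the same prefix).
[cite: MochizukiAbsTopIII2015, Definition 3.5 (ii) p.75] -/
theorem moveHomTS_comp {a c : (logShapeTS (isArc := isArc) v).Vertex} (r : Path a c)
    {g g' g'' : Path c (logShapeTS v).obs}
    (α : (L.logDiagramTS v).pathFunctor g ⟶ (L.logDiagramTS v).pathFunctor g')
    (β : (L.logDiagramTS v).pathFunctor g' ⟶ (L.logDiagramTS v).pathFunctor g'')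
    {p p' p'' : Path a (logShapeTS v).obs} (hp : p = r.comp g) (hp' : p' = r.comp g') (hp'' : p'' = r.comp g'') :
    (L.logDiagramTS v).moveHom r α hp hp' ≫ (L.logDiagramTS v).moveHom r β hp' hp'' =
      (L.logDiagramTS v).moveHom r (α ≫ β) hp hp'' := by
  subst hp hp' hp''
  simp only [DiagramOfCategories.moveHom, Category.assoc, eqToHom_trans_assoc, eqToHom_refl, Category.id_comp,
    Functor.whiskerLeft_comp]

/-- **First-move analysis of a chain out of `[𝒩⊞→𝒩]∘[λ⊞_ν]∘r`** for a vertex `ν` other than the space-link vertex: the chain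
is empty, or its first move is the `pre`-move along some edge `ν → ν₃` of `Γ⃗^log_v` (unique decomposition: no `post`-move
applies, since `λ⊞_ν ≠ λ⊞_{sl}`). [cite: MochizukiAbsTopIII2015, Cor 5.5 (iii) p. 131] -/
theorem chain_from_lamPathTS {a : (logShapeTS (isArc := isArc) v).Vertex}
    (r : Path a ((logShapeTS (isArc := isArc) v).base ⟨.core, core_mem_portion v⟩)) {ν : LogVertex (isArc v)}
    (h : ν.isPostLog = false) (hν : ν ≠ LogVertex.spaceLink (isArc v))
    {q : Path a (logShapeTS v).obs} (c : DiagramOfCategories.Chain (LogGenTS v) (r.comp (lamPathTS v ν h)) q) :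
    (∃ e : r.comp (lamPathTS v ν h) = q, c.hom (L.logGenHomTS v T) = eqToHom (by rw [e])) ∨
      ∃ (ν₃ : LogVertex (isArc v)) (h₃ : ν₃.isPostLog = false) (δ : LogEdgeTS (isArc v) ν ν₃)
        (c₂ : DiagramOfCategories.Chain (LogGenTS v) (r.comp (lamPathTS v ν₃ h₃)) q),
        c.hom (L.logGenHomTS v T) =
          (L.logDiagramTS v).moveHom r (L.logGenHomTS v T (LogGenTS.pre ν ν₃ δ h h₃)) rfl rfl ≫
            c₂.hom (L.logGenHomTS v T) := by
  cases c with
  | nil _ => exact Or.inl ⟨rfl, by simp⟩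
  | cons m rest =>
    right
    obtain ⟨c, r', g, g', s, hp, hp'⟩ := m
    cases s with
    | pre ν₁ ν₂ ε h₁ h₂ =>
      obtain ⟨rfl, rfl⟩ := eq_of_comp_lamPathTS_eq v hp
      subst hp'
      exact ⟨ν₂, h₂, ε, rest, by rw [DiagramOfCategories.Chain.hom_cons]; rfl⟩
    | post ν₁ ν₂ ε h₁ h₂ hsl n =>
      obtain ⟨rfl, -⟩ := eq_of_comp_lamPathTS_eq_comp_postLogDomPathTS v hp
      exact (hν rfl).elim

/-- **A chain out of `[𝒩⊞→𝒩]∘[λ⊞_ν]∘r` for a pre-log SINK `ν ≠ sl` is empty** (no edge of `Γ⃗^log_v` leaves `ν`, so no move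
applies: e.g. `ν = (k̄^×)^pf`). [cite: MochizukiAbsTopIII2015, Cor 5.5 (iii) p. 131] -/
theorem chain_from_lamPathTS_sink {a : (logShapeTS (isArc := isArc) v).Vertex}
    (r : Path a ((logShapeTS (isArc := isArc) v).base ⟨.core, core_mem_portion v⟩)) {ν : LogVertex (isArc v)}
    (h : ν.isPostLog = false) (hν : ν ≠ LogVertex.spaceLink (isArc v)) (hsink : ∀ ν₄, IsEmpty (LogEdgeTS (isArc v) ν ν₄))
    {q : Path a (logShapeTS v).obs} (c : DiagramOfCategories.Chain (LogGenTS v) (r.comp (lamPathTS v ν h)) q) :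
    ∃ e : r.comp (lamPathTS v ν h) = q, c.hom (L.logGenHomTS v T) = eqToHom (by rw [e]) := by
  rcases L.chain_from_lamPathTS v T r h hν c with h' | ⟨ν₃, -, δ, -, -⟩
  · exact h'
  · exact ((hsink ν₃).false δ).elim

/-- **A chain out of `[𝒩⊞→𝒩]∘[λ⊞_{sl}]∘r` (the SPACE-LINK vertex) is empty, or starts with the `post`-move — and then every
later path weighs strictly less than the prefix `r`** (the `post`-move needs `r = [id_⋎]∘[log]∘r'` and trades the weight `3`
of `log` for the rank `< 3` of the post-log arrow's target; no `pre`-move applies, since nothing leaves `k̄`).  This is what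
prevents the `k̄^×`-branch of a fork from meeting the other branch after escaping through `k̄^× ↪ k̄`.
[cite: MochizukiAbsTopIII2015, Cor 5.5 (iii) p. 131] -/
theorem chain_from_lamPathTS_spaceLink {a : (logShapeTS (isArc := isArc) v).Vertex}
    (r : Path a ((logShapeTS (isArc := isArc) v).base ⟨.core, core_mem_portion v⟩))
    (hsl : (LogVertex.spaceLink (isArc v)).isPostLog = false)
    {q : Path a (logShapeTS v).obs}
    (c : DiagramOfCategories.Chain (LogGenTS v) (r.comp (lamPathTS v (LogVertex.spaceLink (isArc v)) hsl)) q) :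
    (∃ e : r.comp (lamPathTS v (LogVertex.spaceLink (isArc v)) hsl) = q, c.hom (L.logGenHomTS v T) = eqToHom (by rw [e])) ∨
      pathWtTS v q < pathWtTS v r := by
  cases c with
  | nil _ => exact Or.inl ⟨rfl, by simp⟩
  | cons m rest =>
    right
    obtain ⟨c, r', g, g', s, hp, hp'⟩ := m
    cases s with
    | pre ν₁ ν₂ ε h₁ h₂ =>
      obtain ⟨rfl, -⟩ := eq_of_comp_lamPathTS_eq v hp
      exact ((LogVertex.isEmpty_logEdgeTS_spaceLink _ ν₂).false ε).elim
    | post ν₁ ν₂ ε h₁ h₂ hsl' n =>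
      obtain ⟨-, rfl⟩ := eq_of_comp_lamPathTS_eq_comp_postLogDomPathTS v hp
      have hw := pathWtTS_le_of_chain v rest
      rw [hp', pathWtTS_comp, pathWtTS_postLogCodPathTS] at hw
      have hr := pathWtTS_cons_log_toCore v n r'
      have h₃ := LogVertex.rankTS_lt_of_logEdgeTS_post _ ε h₁
      omega

/-- **The square of generator homotopies commutes** when the `TS` ι-diamond law holds: for a fork `ν₁ → a`, `ν₁ → c` closing
into `ν₃`, the two composites of `pre`-moves with a common prefix `r` agree. [cite: MochizukiAbsTopIII2015, Cor 5.5 (iii) p. 131] -/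
theorem moveHomTS_square (hsq : L.IotaSquaresCommuteTS T v) {a₀ : (logShapeTS (isArc := isArc) v).Vertex}
    (r : Path a₀ ((logShapeTS (isArc := isArc) v).base ⟨.core, core_mem_portion v⟩)) {ν₁ a c ν₃ : LogVertex (isArc v)}
    (h₁ : ν₁.isPostLog = false) (ha : a.isPostLog = false) (hc : c.isPostLog = false) (h₃ : ν₃.isPostLog = false)
    (ε : LogEdgeTS (isArc v) ν₁ a) (δ : LogEdgeTS (isArc v) a ν₃) (ε' : LogEdgeTS (isArc v) ν₁ c)
    (δ' : LogEdgeTS (isArc v) c ν₃) :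
    (L.logDiagramTS v).moveHom r (L.logGenHomTS v T (LogGenTS.pre ν₁ a ε h₁ ha)) rfl rfl ≫
        (L.logDiagramTS v).moveHom r (L.logGenHomTS v T (LogGenTS.pre a ν₃ δ ha h₃)) rfl rfl =
      (L.logDiagramTS v).moveHom r (L.logGenHomTS v T (LogGenTS.pre ν₁ c ε' h₁ hc)) rfl rfl ≫
        (L.logDiagramTS v).moveHom r (L.logGenHomTS v T (LogGenTS.pre c ν₃ δ' hc h₃)) rfl rfl := by
  rw [moveHomTS_comp, moveHomTS_comp]
  congr 1
  ext X₀
  have key := hsq ha hc ε δ ε' δ' X₀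
  simp only [logGenHomTS, NatTrans.comp_app, eqToHom_app, Category.assoc, eqToHom_trans_assoc]
  congr 1
  simp only [← Category.assoc]
  congr 1
  simp only [Category.assoc]
  convert key using 3 <;> rfl

/-! ## Coherence of the move system of `S_log` -/

/-- **The CLOSING fork cannot produce two different homotopies.**  For the fork `ν₁ → a`, `ν₁ → c` of
`LogVertex.logEdgeTS_fork` (closing into the pre-log sink `ν₃ ≠ sl`, `c` with no other exit, `a` with at most the further
exit into `sl`), two chains continuing the two branches to a common path `q` have equal composites: both must reach
`q = [λ_{ν₃}]∘r` through `ν₃` (the escape of the `a`-branch through `sl` leads only to paths lighter than `r`, and the sink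
`ν₃` admits no further move), where the square `moveHomTS_square` applies. [cite: MochizukiAbsTopIII2015, Cor 5.5 (iii) p. 131] -/
theorem fork_closing_hom_eq (hsq : L.IotaSquaresCommuteTS T v) {a₀ : (logShapeTS (isArc := isArc) v).Vertex}
    (r : Path a₀ ((logShapeTS (isArc := isArc) v).base ⟨.core, core_mem_portion v⟩)) {ν₁ a c ν₃ : LogVertex (isArc v)}
    (h₁ : ν₁.isPostLog = false) (ha : a.isPostLog = false) (hc : c.isPostLog = false) (h₃ : ν₃.isPostLog = false)
    (ε : LogEdgeTS (isArc v) ν₁ a) (ε' : LogEdgeTS (isArc v) ν₁ c) (δ : LogEdgeTS (isArc v) a ν₃)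
    (δ' : LogEdgeTS (isArc v) c ν₃) (hν₃ : ν₃ ≠ LogVertex.spaceLink (isArc v))
    (hsink : ∀ ν₄, IsEmpty (LogEdgeTS (isArc v) ν₃ ν₄))
    (hout : ∀ ν₄, LogEdgeTS (isArc v) a ν₄ → ν₄ = ν₃ ∨ ν₄ = LogVertex.spaceLink (isArc v))
    (hout' : ∀ ν₄, LogEdgeTS (isArc v) c ν₄ → ν₄ = ν₃) (hac : a ≠ c) {q : Path a₀ (logShapeTS v).obs}
    (rest : DiagramOfCategories.Chain (LogGenTS v) (r.comp (lamPathTS v a ha)) q)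
    (rest' : DiagramOfCategories.Chain (LogGenTS v) (r.comp (lamPathTS v c hc)) q) :
    (L.logDiagramTS v).moveHom r (L.logGenHomTS v T (LogGenTS.pre ν₁ a ε h₁ ha)) rfl rfl ≫ rest.hom (L.logGenHomTS v T) =
      (L.logDiagramTS v).moveHom r (L.logGenHomTS v T (LogGenTS.pre ν₁ c ε' h₁ hc)) rfl rfl ≫
        rest'.hom (L.logGenHomTS v T) := by
  have hane : a ≠ LogVertex.spaceLink (isArc v) := LogVertex.ne_spaceLink_of_logEdgeTS _ δ
  have hcne : c ≠ LogVertex.spaceLink (isArc v) := LogVertex.ne_spaceLink_of_logEdgeTS _ δ'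
  have hwq : ∀ {ν : LogVertex (isArc v)} {hν : ν.isPostLog = false}, r.comp (lamPathTS v ν hν) = q →
      pathWtTS v r ≤ pathWtTS v q := by
    rintro ν hν rfl
    rw [pathWtTS_comp]
    exact Nat.le_add_right _ _
  -- the `c`-branch: empty, or through `ν₃` and then empty
  rcases L.chain_from_lamPathTS v T r hc hcne rest' with ⟨e', he'⟩ | ⟨ν₄', h₄', γ', c₂', hc₂'⟩
  · -- `rest'` empty: `q = [λ_c]∘r`; the `a`-branch cannot reach it
    exfalso
    rcases L.chain_from_lamPathTS v T r ha hane rest with ⟨e, -⟩ | ⟨ν₄, h₄, γ, c₂, -⟩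
    · exact hac (eq_of_comp_lamPathTS_eq v (e.trans e'.symm)).1
    · rcases hout ν₄ γ with h₄₃ | rfl
      · subst h₄₃
        obtain ⟨e₂, -⟩ := L.chain_from_lamPathTS_sink v T r h₄ hν₃ hsink c₂
        have h₃c := (eq_of_comp_lamPathTS_eq v (e₂.trans e'.symm)).1
        exact (LogVertex.rankTS_lt_of_logEdgeTS _ δ' hc).ne (congrArg (LogVertex.rankTS (isArc v)) h₃c)
      · rcases L.chain_from_lamPathTS_spaceLink v T r h₄ c₂ with ⟨e₂, -⟩ | hw
        · exact hcne (eq_of_comp_lamPathTS_eq v (e'.trans e₂.symm)).1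
        · exact absurd (hwq e') (not_le.mpr hw)
  · have h₄₃' := hout' ν₄' γ'
    subst h₄₃'
    rw [LogVertex.logEdgeTS_subsingleton _ γ' δ'] at hc₂'
    obtain ⟨e', hc₂'e⟩ := L.chain_from_lamPathTS_sink v T r h₃ hν₃ hsink c₂'
    -- the `a`-branch must also pass through `ν₃`
    rcases L.chain_from_lamPathTS v T r ha hane rest with ⟨e, -⟩ | ⟨ν₄, h₄, γ, c₂, hc₂⟩
    · exfalso
      have ha₃ := (eq_of_comp_lamPathTS_eq v (e.trans e'.symm)).1
      exact (LogVertex.rankTS_lt_of_logEdgeTS _ δ ha).ne' (congrArg (LogVertex.rankTS (isArc v)) ha₃)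
    · rcases hout ν₄ γ with h₄₃ | rfl
      · subst h₄₃
        rw [LogVertex.logEdgeTS_subsingleton _ γ δ] at hc₂
        obtain ⟨e, hc₂e⟩ := L.chain_from_lamPathTS_sink v T r h₃ hν₃ hsink c₂
        rw [hc₂, hc₂', hc₂e, hc₂'e, ← Category.assoc, ← Category.assoc]
        congr 1
        exact L.moveHomTS_square v T hsq r h₁ ha hc h₃ ε δ ε' δ'
      · exfalso
        rcases L.chain_from_lamPathTS_spaceLink v T r h₄ c₂ with ⟨e₂, -⟩ | hw
        · exact hν₃ (eq_of_comp_lamPathTS_eq v (e'.trans e₂.symm)).1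
        · exact absurd (hwq e') (not_le.mpr hw)

include L T in
/-- **The DIVERGING fork cannot be rejoined**: no two chains continue the branches `ν₁ → sl` and `ν₁ → c` (`c` a pre-log sink
other than `sl`) to a common path. [cite: MochizukiAbsTopIII2015, Cor 5.5 (iii) p. 131] -/
theorem fork_diverging_false {a₀ : (logShapeTS (isArc := isArc) v).Vertex}
    (r : Path a₀ ((logShapeTS (isArc := isArc) v).base ⟨.core, core_mem_portion v⟩)) {c : LogVertex (isArc v)}
    (hsl : (LogVertex.spaceLink (isArc v)).isPostLog = false) (hc : c.isPostLog = false)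
    (hcne : c ≠ LogVertex.spaceLink (isArc v)) (hsink : ∀ ν₄, IsEmpty (LogEdgeTS (isArc v) c ν₄))
    {q : Path a₀ (logShapeTS v).obs}
    (rest : DiagramOfCategories.Chain (LogGenTS v) (r.comp (lamPathTS v (LogVertex.spaceLink (isArc v)) hsl)) q)
    (rest' : DiagramOfCategories.Chain (LogGenTS v) (r.comp (lamPathTS v c hc)) q) : False := by
  obtain ⟨e', -⟩ := L.chain_from_lamPathTS_sink v T r hc hcne hsink rest'
  rcases L.chain_from_lamPathTS_spaceLink v T r hsl rest with ⟨e, -⟩ | hw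
  · exact hcne (eq_of_comp_lamPathTS_eq v (e'.trans e.symm)).1
  · have : pathWtTS v r ≤ pathWtTS v q := by
      rw [← e', pathWtTS_comp]
      exact Nat.le_add_right _ _
    omega

/-- **COHERENCE of the move system of `S_log`**: if the `TS` ι-diamond law holds at `v`, any two chains of moves between the
same two paths of the `TS`-shape have the same homotopy.  (Induction on the weight of the source path: the first moves of
two chains out of a path coincide — unique decomposition — unless they form a fork of `Γ⃗^log_v`; the closing fork gives
equal composites by `fork_closing_hom_eq`, the diverging fork is impossible by `fork_diverging_false`.)
[cite: MochizukiAbsTopIII2015, Cor 5.5 (iii) p. 131] -/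
theorem chain_hom_eq_of_iotaSquaresCommuteTS (hsq : L.IotaSquaresCommuteTS T v) :
    ∀ (n : ℕ) {a : (logShapeTS (isArc := isArc) v).Vertex} {p q : Path a (logShapeTS v).obs}
      (c c' : DiagramOfCategories.Chain (LogGenTS v) p q), pathWtTS v p < n →
      c.hom (L.logGenHomTS v T) = c'.hom (L.logGenHomTS v T)
  | 0, _, _, _, _, _, h => absurd h (Nat.not_lt_zero _)
  | n + 1, a, p, q, c, c', hlt => by
    have IH : ∀ {p' q' : Path a (logShapeTS v).obs} (d d' : DiagramOfCategories.Chain (LogGenTS v) p' q'),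
        pathWtTS v p' < pathWtTS v p → d.hom (L.logGenHomTS v T) = d'.hom (L.logGenHomTS v T) :=
      fun d d' h => chain_hom_eq_of_iotaSquaresCommuteTS hsq n d d' (by omega)
    cases c with
    | nil _ =>
      cases c' with
      | nil _ => rfl
      | cons m' rest' => exact absurd (pathWtTS_lt_of_cons v m' rest') (lt_irrefl _)
    | cons m rest =>
      cases c' with
      | nil _ => exact absurd (pathWtTS_lt_of_cons v m rest) (lt_irrefl _)
      | cons m' rest' =>
        rw [DiagramOfCategories.Chain.hom_cons, DiagramOfCategories.Chain.hom_cons]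
        obtain ⟨c₁, r₁, g₁, g₁', s₁, hp₁, hp₁'⟩ := m
        obtain ⟨c₂, r₂, g₂, g₂', s₂, hp₂, hp₂'⟩ := m'
        cases s₁ with
        | pre ν₁ ν₂ ε h₁ h₂ =>
          cases s₂ with
          | pre ν₁' ν₂' ε' h₁' h₂' =>
            obtain ⟨rfl, rfl⟩ := eq_of_comp_lamPathTS_eq v (hp₁.symm.trans hp₂)
            subst hp₁ hp₁' hp₂'
            by_cases hν : ν₂ = ν₂'
            · subst hν
              obtain rfl : ε = ε' := LogVertex.logEdgeTS_subsingleton _ ε ε'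
              have hw₂ : pathWtTS v (r₁.comp (lamPathTS v ν₂ h₂)) < pathWtTS v (r₁.comp (lamPathTS v ν₁ h₁)) := by
                rw [pathWtTS_comp, pathWtTS_comp, pathWtTS_lamPathTS, pathWtTS_lamPathTS]
                exact Nat.add_lt_add_left (LogVertex.rankTS_lt_of_logEdgeTS _ ε h₁) _
              congr 1
              exact IH rest rest' hw₂
            · rcases LogVertex.logEdgeTS_fork _ h₁ ε ε' hν with
                ⟨a', c', hac, ν₃, δ, δ', h₃, hν₃, hsink, hout, hout'⟩ | ⟨a', c', hac, hsl, hc', hcne, hsink⟩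
              · rcases hac with ⟨rfl, rfl⟩ | ⟨rfl, rfl⟩
                · exact L.fork_closing_hom_eq v T hsq r₁ h₁ h₂ h₂' h₃ ε ε' δ δ' hν₃ hsink hout hout' hν rest rest'
                · exact (L.fork_closing_hom_eq v T hsq r₁ h₁ h₂' h₂ h₃ ε' ε δ δ' hν₃ hsink hout hout' (Ne.symm hν)
                    rest' rest).symm
              · rcases hac with ⟨rfl, rfl⟩ | ⟨rfl, rfl⟩
                · subst hsl
                  exact (L.fork_diverging_false v T r₁ h₂ h₂' hcne hsink rest rest').elim
                · subst hsl
                  exact (L.fork_diverging_false v T r₁ h₂' h₂ hcne hsink rest' rest).elim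
          | post ν₁' ν₂' ε' h₁' h₂' hsl' n' =>
            obtain ⟨rfl, -⟩ := eq_of_comp_lamPathTS_eq_comp_postLogDomPathTS v (hp₁.symm.trans hp₂)
            exact ((LogVertex.isEmpty_logEdgeTS_spaceLink _ ν₂).false ε).elim
        | post ν₁ ν₂ ε h₁ h₂ hsl k =>
          cases s₂ with
          | pre ν₁' ν₂' ε' h₁' h₂' =>
            obtain ⟨rfl, -⟩ := eq_of_comp_lamPathTS_eq_comp_postLogDomPathTS v (hp₂.symm.trans hp₁)
            exact ((LogVertex.isEmpty_logEdgeTS_spaceLink _ ν₂').false ε').elim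
          | post ν₁' ν₂' ε' h₁' h₂' hsl' k' =>
            obtain ⟨rfl, hr⟩ := eq_of_comp_postLogDomPathTS_eq v (hp₁.symm.trans hp₂)
            obtain rfl := eq_of_heq hr
            obtain rfl : ν₁ = ν₁' :=
              (LogVertex.eq_postLog_of_isPostLog _ h₁).trans (LogVertex.eq_postLog_of_isPostLog _ h₁').symm
            obtain rfl : ν₂ = ν₂' := LogVertex.logEdgeTS_post_target_eq _ h₁ ε ε'
            obtain rfl : ε = ε' := LogVertex.logEdgeTS_subsingleton _ ε ε'
            subst hp₁ hp₁' hp₂'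
            have hw₂ : pathWtTS v (r₁.comp (postLogCodPathTS v k ν₂ h₂)) <
                pathWtTS v (r₁.comp (postLogDomPathTS v k hsl)) := by
              rw [pathWtTS_comp, pathWtTS_comp, pathWtTS_postLogDomPathTS, pathWtTS_postLogCodPathTS]
              exact Nat.add_lt_add_left (LogVertex.rankTS_lt_of_logEdgeTS_post _ ε h₁) _
            congr 1
            exact IH rest rest' hw₂

/-- Coherence in the form consumed by the toolkit: any two chains between the same two paths into `𝒩_v` have the same
homotopy. [cite: MochizukiAbsTopIII2015, Cor 5.5 (iii) p. 131] -/
theorem chain_hom_eq_TS (hsq : L.IotaSquaresCommuteTS T v) {a : (logShapeTS (isArc := isArc) v).Vertex}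
    (p q : Path a (logShapeTS v).obs) (c c' : DiagramOfCategories.Chain (LogGenTS v) p q) :
    c.hom (L.logGenHomTS v T) = c'.hom (L.logGenHomTS v T) :=
  L.chain_hom_eq_of_iotaSquaresCommuteTS v T hsq (pathWtTS v p + 1) c c' (Nat.lt_succ_self _)

end LogFrobeniusSetting

end Literature.AnabelianGeometry.AbsoluteAnabelian
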